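import Mathlib.MeasureTheory.Function.SpecialFunctions.Basic
import Mathlib.MeasureTheory.Function.SpecialFunctions.Inner
import Literature.MathematicalPhysics.KineticTheory.CollisionTubeFunctional
import Literature.MathematicalPhysics.KineticTheory.HardSphereEulerProofs
import Literature.Analysis.FluidPDE.HardSphereRegularGeometry
import HarnessLib

/-!
# Regularity of the fixed-time collision-tube functional (`stub_tubeStatRegular`, S6 of the crux
# line `equilibrium-rung-mean-variance`, `JParityClosure.OddContactSymmetry`,
# stmt-AtomisticToContinuum-13078)

For continuous marks `χ, g, Ψ` with `Ψ` bounded, `r > 0`, `L ≥ 0`, `κ ≥ 0` and any `τ`, the tube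
functional `A_t(z) = tubeStat σ N χ g Ψ r ϑ L κ t z` of
`Literature.MathematicalPhysics.KineticTheory.CollisionTubeFunctional` is

* jointly Borel measurable in `(t, z) ∈ ℝ × Config (N+1) (Fin 3) 𝕋³` (`measurable_tubeStat_uncurry`):
  a finite double sum of `if … then … else 0` over the tube predicate (strict/weak inequalities
  between measurable real functions of `z`) of products of measurable functions; the empirical
  integrals are finite averages (`integral_empiricalMeasure`), the minimal-image separation
  `sepVec x y = reprSym (x - y)` is measurable (`Torus.measurable_reprSym`), and `Real.log`, `min`,
  `Real.sqrt`, division are measurable;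
* uniformly bounded on `[0, τ] × Config` (`exists_bound_tubeStat`): `χ` is bounded on the compact
  `[0, τ] × 𝕋³`, the cone-mollified empirical density lies in `[0, 3/(π r³)]` so `g` is only
  evaluated on a compact interval, `|Ψ| ≤ C_Ψ`, the truncated reweighting lies in `[0, L]`, and at
  most `(N+1)²` ordered pairs carry the weight `((N+1)κ)⁻¹ ≥ 0` (cf. `abs_tubeStat_le`).

The registered stub `stub_tubeStatRegular` is the conjunction.
-/

noncomputable section

open MeasureTheory Set
open scoped ENNReal InnerProductSpace BigOperators

namespace Summit.AtomisticToContinuum.HydrodynamicLimit.Theorems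

open Literature.Analysis.FluidPDE Literature.MathematicalPhysics.KineticTheory

/-! ## Measurable building blocks (compositional form, registered locally for `fun_prop`) -/

section MeasurableBlocks

variable {α : Type*} [MeasurableSpace α]

/-- The symmetric representative `reprSym : 𝕋³ → ℝ³` composed with a measurable map is
measurable. [folklore] -/
theorem measurable_reprSym_comp {f : α → UnitAddTorus (Fin 3)} (hf : Measurable f) :
    Measurable fun a => Torus.reprSym (f a) :=
  Torus.measurable_reprSym.comp hf

/-- The minimal-image distance of two measurable torus-valued maps is measurable. [folklore] -/
theorem measurable_euclidDist_comp {f g : α → UnitAddTorus (Fin 3)} (hf : Measurable f)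
    (hg : Measurable g) : Measurable fun a => Torus.euclidDist (f a) (g a) := by
  simp only [Torus.euclidDist_eq]
  exact (Torus.measurable_reprSym.comp (hf.sub hg)).norm

/-- The elastic reflection law is jointly measurable in the impact direction and the velocity
pair. [folklore] -/
theorem measurable_reflectVel_comp {n : α → V3} {p : α → V3 × V3} (hn : Measurable n)
    (hp : Measurable p) : Measurable fun a => reflectVel (n a) (p a) := by
  have hc : Measurable fun a => ⟪(p a).1 - (p a).2, n a⟫_ℝ / ‖n a‖ ^ 2 :=
    ((hp.fst.sub hp.snd).inner hn).div (hn.norm.pow_const 2)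
  unfold reflectVel
  exact (hp.fst.sub (hc.smul hn)).prodMk (hp.snd.add (hc.smul hn))

/-- The local Maxwellian is jointly measurable in bulk velocity and velocity. [folklore] -/
theorem measurable_localMaxwellian_comp (ρ θ : ℝ) {u v : α → V3} (hu : Measurable u)
    (hv : Measurable v) : Measurable fun a => localMaxwellian ρ θ (u a) (v a) := by
  unfold localMaxwellian
  fun_prop

/-- The tube predicate `P ∧ f₁ < g₁ ∧ f₂ < g₂ ∧ f₃ ≤ g₃ ∧ f₄ ≤ g₄` of measurable real functions
cuts out a measurable set. [folklore] -/
theorem measurableSet_tubePred (P : Prop) {f₁ g₁ f₂ g₂ f₃ g₃ f₄ g₄ : α → ℝ}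
    (hf₁ : Measurable f₁) (hg₁ : Measurable g₁) (hf₂ : Measurable f₂) (hg₂ : Measurable g₂)
    (hf₃ : Measurable f₃) (hg₃ : Measurable g₃) (hf₄ : Measurable f₄) (hg₄ : Measurable g₄) :
    MeasurableSet {a | P ∧ f₁ a < g₁ a ∧ f₂ a < g₂ a ∧ f₃ a ≤ g₃ a ∧ f₄ a ≤ g₄ a} :=
  (MeasurableSet.const P).inter ((measurableSet_lt hf₁ hg₁).inter ((measurableSet_lt hf₂ hg₂).inter
    ((measurableSet_le hf₃ hg₃).inter (measurableSet_le hf₄ hg₄))))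

end MeasurableBlocks

attribute [local fun_prop] measurable_reprSym_comp measurable_euclidDist_comp
  measurable_reflectVel_comp measurable_localMaxwellian_comp

/-! ## Joint measurability of `(t, z) ↦ A_t(z)` -/

/-- **Joint Borel measurability of the tube functional** `(t, z) ↦ tubeStat σ N χ g Ψ r ϑ L κ t z`
on `ℝ × Config (N+1) (Fin 3) 𝕋³`, for continuous `χ, g, Ψ`. [folklore] -/
theorem measurable_tubeStat_uncurry (σ : ℝ) (N : ℕ) {χ : ℝ × UnitAddTorus (Fin 3) → ℝ}
    {g : ℝ → ℝ} {Ψ : EuclideanSpace ℝ (Fin 3) × EuclideanSpace ℝ (Fin 3) × EuclideanSpace ℝ (Fin 3) → ℝ}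
    (hχ : Continuous χ) (hg : Continuous g) (hΨ : Continuous Ψ) (r ϑ L κ : ℝ) :
    Measurable (fun p : ℝ × Config (N + 1) (Fin 3) T3 => tubeStat σ N χ g Ψ r ϑ L κ p.1 p.2) := by
  have hχm : Measurable χ := hχ.measurable
  have hgm : Measurable g := hg.measurable
  have hΨm : Measurable Ψ := hΨ.measurable
  dsimp only [tubeStat]
  simp only [integral_empiricalMeasure, Torus.geometry_sepVec]
  refine Measurable.const_mul ?_ _
  refine Finset.measurable_sum _ fun i _ => Finset.measurable_sum _ fun j _ => ?_
  refine Measurable.ite (measurableSet_tubePred _ ?_ ?_ ?_ ?_ ?_ ?_ ?_ ?_) ?_ measurable_const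
  all_goals fun_prop

/-! ## The uniform bound on `[0, τ] × Config` -/

/-- Elementary bound for a doubly indexed sum over `Fin (N+1) × Fin (N+1)` scaled by a nonnegative
constant: `|c Σᵢ Σⱼ sᵢⱼ| ≤ c (N+1)² B` when `|sᵢⱼ| ≤ B` (re-proof of the private
`abs_const_mul_sum_sum_le` of `CollisionTubeFunctional`). [folklore] -/
theorem abs_const_mul_sum_sum_le_of {N : ℕ} {c B : ℝ} (hc : 0 ≤ c)
    (s : Fin (N + 1) → Fin (N + 1) → ℝ) (hs : ∀ i j, |s i j| ≤ B) :
    |c * ∑ i, ∑ j, s i j| ≤ c * ((N + 1 : ℝ) ^ 2 * B) := by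
  rw [abs_mul, abs_of_nonneg hc]
  refine mul_le_mul_of_nonneg_left ?_ hc
  calc |∑ i, ∑ j, s i j| ≤ ∑ i, |∑ j, s i j| := Finset.abs_sum_le_sum_abs _ _
    _ ≤ ∑ i, ∑ j, |s i j| := Finset.sum_le_sum fun i _ => Finset.abs_sum_le_sum_abs _ _
    _ ≤ ∑ _i : Fin (N + 1), ∑ _j : Fin (N + 1), B :=
        Finset.sum_le_sum fun i _ => Finset.sum_le_sum fun j _ => hs i j
    _ = (N + 1 : ℝ) ^ 2 * B := by
        simp only [Finset.sum_const, Finset.card_univ, Fintype.card_fin, nsmul_eq_mul]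
        push_cast
        ring

/-- Elementary bound for one mark `χ · g · (Ψ · m)` with `0 ≤ m ≤ L` (re-proof of the private
`abs_mark_le` of `CollisionTubeFunctional`). [folklore] -/
theorem abs_mark_le_of {x₁ x₂ x₃ m C₁ C₂ C₃ L' : ℝ} (h₁ : |x₁| ≤ C₁) (h₂ : |x₂| ≤ C₂)
    (h₃ : |x₃| ≤ C₃) (hm0 : 0 ≤ m) (hmL : m ≤ L') :
    |x₁ * x₂ * (x₃ * m)| ≤ C₁ * C₂ * (C₃ * L') := by
  have hC₁ : 0 ≤ C₁ := (abs_nonneg _).trans h₁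
  have hC₃ : 0 ≤ C₃ := (abs_nonneg _).trans h₃
  have hm : |m| ≤ L' := by rwa [abs_of_nonneg hm0]
  rw [abs_mul, abs_mul, abs_mul]
  exact mul_le_mul (mul_le_mul h₁ h₂ (abs_nonneg _) hC₁) (mul_le_mul h₃ hm (abs_nonneg _) hC₃)
    (by positivity) (mul_nonneg hC₁ ((abs_nonneg _).trans h₂))

/-- The cone kernel `bx x y = 3/(π r³) · max(1 − d(x,y)/r, 0)` takes values in `[0, 3/(π r³)]`
for `r > 0` (`d = Torus.euclidDist ≥ 0` is a norm). [folklore] -/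
theorem coneKernel_nonneg_le {r : ℝ} (hr : 0 < r) (x y : UnitAddTorus (Fin 3)) :
    0 ≤ 3 / (Real.pi * r ^ 3) * max (1 - Torus.euclidDist x y / r) 0 ∧
      3 / (Real.pi * r ^ 3) * max (1 - Torus.euclidDist x y / r) 0 ≤ 3 / (Real.pi * r ^ 3) := by
  have hM : 0 ≤ 3 / (Real.pi * r ^ 3) := by positivity
  have hd : 0 ≤ Torus.euclidDist x y := norm_nonneg _
  refine ⟨mul_nonneg hM (le_max_right _ _), ?_⟩
  have h1 : max (1 - Torus.euclidDist x y / r) 0 ≤ 1 :=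
    max_le (by linarith [div_nonneg hd hr.le]) zero_le_one
  calc 3 / (Real.pi * r ^ 3) * max (1 - Torus.euclidDist x y / r) 0
      ≤ 3 / (Real.pi * r ^ 3) * 1 := mul_le_mul_of_nonneg_left h1 hM
    _ = 3 / (Real.pi * r ^ 3) := mul_one _

/-- The cone-mollified empirical density `ρ_r(x₀) = ∫ bx(q.1, x₀) dμ_z ∈ [0, 3/(π r³)]` (a finite
average of cone kernels, `integral_empiricalMeasure`), so `|σ³ ρ_r(x₀)| ≤ |σ|³ · 3/(π r³)`: the
argument of `g` in the tube functional ranges in a compact interval. [folklore] -/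
theorem abs_cube_mul_empiricalDensity_le (σ : ℝ) {N : ℕ} {r : ℝ} (hr : 0 < r)
    (z : Config (N + 1) (Fin 3) T3) (x₀ : UnitAddTorus (Fin 3)) :
    |σ ^ 3 * ∫ q, 3 / (Real.pi * r ^ 3) * max (1 - Torus.euclidDist q.1 x₀ / r) 0
        ∂(empiricalMeasure z)| ≤ |σ| ^ 3 * (3 / (Real.pi * r ^ 3)) := by
  rw [integral_empiricalMeasure, abs_mul, abs_pow]
  refine mul_le_mul_of_nonneg_left ?_ (pow_nonneg (abs_nonneg σ) 3)
  have hn : (0 : ℝ) < ((N + 1 : ℕ) : ℝ) := by exact_mod_cast Nat.succ_pos N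
  have hsum0 : 0 ≤ ∑ k, 3 / (Real.pi * r ^ 3) * max (1 - Torus.euclidDist (z k).1 x₀ / r) 0 :=
    Finset.sum_nonneg fun k _ => (coneKernel_nonneg_le hr (z k).1 x₀).1
  have hsumM : ∑ k, 3 / (Real.pi * r ^ 3) * max (1 - Torus.euclidDist (z k).1 x₀ / r) 0 ≤
      ((N + 1 : ℕ) : ℝ) * (3 / (Real.pi * r ^ 3)) := by
    calc ∑ k, 3 / (Real.pi * r ^ 3) * max (1 - Torus.euclidDist (z k).1 x₀ / r) 0
        ≤ ∑ _k : Fin (N + 1), 3 / (Real.pi * r ^ 3) :=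
          Finset.sum_le_sum fun k _ => (coneKernel_nonneg_le hr (z k).1 x₀).2
      _ = ((N + 1 : ℕ) : ℝ) * (3 / (Real.pi * r ^ 3)) := by
          rw [Finset.sum_const, Finset.card_univ, Fintype.card_fin, nsmul_eq_mul]
  rw [abs_of_nonneg (mul_nonneg (inv_nonneg.2 hn.le) hsum0), inv_mul_le_iff₀ hn]
  exact hsumM

/-- **Sup bound for the tube functional with `g` bounded only on the range of `σ³ ρ_r`.**  If
`|χ(t, ·)| ≤ C_χ`, `|g a| ≤ C_g` for `|a| ≤ |σ|³ · 3/(π r³)`, `|Ψ| ≤ C_Ψ`, `r > 0`, `0 ≤ L` and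
`0 ≤ κ`, then `|A_t(z)| ≤ ((N+1)κ)⁻¹ · (N+1)² · C_χ C_g C_Ψ L` for every configuration `z`
(the proof of `abs_tubeStat_le`, with the range lemma `abs_cube_mul_empiricalDensity_le`).
[folklore] -/
theorem abs_tubeStat_le_of_range {σ : ℝ} {N : ℕ} {χ : ℝ × UnitAddTorus (Fin 3) → ℝ} {g : ℝ → ℝ}
    {Ψ : EuclideanSpace ℝ (Fin 3) × EuclideanSpace ℝ (Fin 3) × EuclideanSpace ℝ (Fin 3) → ℝ}
    {r ϑ L κ t Cχ Cg CΨ : ℝ} (hχ : ∀ x, |χ (t, x)| ≤ Cχ)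
    (hg : ∀ a, |a| ≤ |σ| ^ 3 * (3 / (Real.pi * r ^ 3)) → |g a| ≤ Cg) (hΨ : ∀ p, |Ψ p| ≤ CΨ)
    (hr : 0 < r) (hL : 0 ≤ L) (hκ : 0 ≤ κ) (z : Config (N + 1) (Fin 3) T3) :
    |tubeStat σ N χ g Ψ r ϑ L κ t z| ≤
      ((N + 1 : ℝ) * κ)⁻¹ * ((N + 1 : ℝ) ^ 2 * (Cχ * Cg * (CΨ * L))) := by
  have hCχ : 0 ≤ Cχ := (abs_nonneg _).trans (hχ (z 0).1)
  have hCg : 0 ≤ Cg := (abs_nonneg _).trans (hg 0 (by rw [abs_zero]; positivity))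
  have hCΨ : 0 ≤ CΨ := (abs_nonneg _).trans (hΨ 0)
  dsimp only [tubeStat]
  refine abs_const_mul_sum_sum_le_of (by positivity) _ fun i j => ?_
  split_ifs with h
  · exact abs_mark_le_of (hχ _) (hg _ (abs_cube_mul_empiricalDensity_le σ hr z _)) (hΨ _)
      (le_min (by positivity) hL) (min_le_right _ _)
  · rw [abs_zero]; positivity

/-- **Uniform bound for the tube functional on `[0, τ] × Config`.**  For continuous `χ, g`,
bounded `Ψ`, `r > 0`, `0 ≤ L`, `0 ≤ κ`: there is `B` with `|A_t(z)| ≤ B` for all `t ∈ [0, τ]` and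
ALL configurations `z`.  `χ` is bounded on the compact `[0, τ] × 𝕋³`, `g` on the compact interval
`[-|σ|³ · 3/(π r³), |σ|³ · 3/(π r³)]` containing every `σ³ ρ_r(xᵢ)`; then
`abs_tubeStat_le_of_range`. [folklore] -/
theorem exists_bound_tubeStat (σ : ℝ) (N : ℕ) {χ : ℝ × UnitAddTorus (Fin 3) → ℝ} {g : ℝ → ℝ}
    {Ψ : EuclideanSpace ℝ (Fin 3) × EuclideanSpace ℝ (Fin 3) × EuclideanSpace ℝ (Fin 3) → ℝ}
    (hχ : Continuous χ) (hg : Continuous g) (hΨb : ∃ C : ℝ, ∀ q, |Ψ q| ≤ C) {r : ℝ} (hr : 0 < r)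
    (ϑ : ℝ) {L κ : ℝ} (hL : 0 ≤ L) (hκ : 0 ≤ κ) (τ : ℝ) :
    ∃ B : ℝ, ∀ t ∈ Set.Icc (0 : ℝ) τ, ∀ z : Config (N + 1) (Fin 3) T3,
      |tubeStat σ N χ g Ψ r ϑ L κ t z| ≤ B := by
  obtain ⟨CΨ, hCΨ⟩ := hΨb
  have hK : IsCompact (Set.Icc (0 : ℝ) τ ×ˢ (univ : Set (UnitAddTorus (Fin 3)))) :=
    isCompact_Icc.prod isCompact_univ
  obtain ⟨Cχ, hCχ⟩ := hK.exists_bound_of_continuousOn hχ.continuousOn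
  obtain ⟨Cg, hCg⟩ := (isCompact_Icc (a := -(|σ| ^ 3 * (3 / (Real.pi * r ^ 3))))
    (b := |σ| ^ 3 * (3 / (Real.pi * r ^ 3)))).exists_bound_of_continuousOn hg.continuousOn
  refine ⟨((N + 1 : ℝ) * κ)⁻¹ * ((N + 1 : ℝ) ^ 2 * (Cχ * Cg * (CΨ * L))), fun t ht z => ?_⟩
  refine abs_tubeStat_le_of_range (fun x => ?_) (fun a ha => ?_) hCΨ hr hL hκ z
  · simpa only [Real.norm_eq_abs] using hCχ (t, x) ⟨ht, mem_univ _⟩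
  · simpa only [Real.norm_eq_abs] using hCg a (abs_le.1 ha)

/-! ## The registered stub -/

/-- **S6 · regularity of the tube functional** (registered stub `stub_tubeStatRegular` of the line
`equilibrium-rung-mean-variance`, verbatim).  For continuous `χ, g, Ψ` with `Ψ` bounded, `r > 0`,
`L ≥ 0`, `κ ≥ 0` and any `τ`: (i) `(t, z) ↦ A_t(z) = tubeStat σ N χ g Ψ r ϑ L κ t z` is Borel
measurable on `ℝ × Config` (`measurable_tubeStat_uncurry`); (ii) `|A_t(z)| ≤ B` uniformly on
`[0, τ] × Config` (`exists_bound_tubeStat`). [folklore] -/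
theorem stub_tubeStatRegular :
    ∀ (σ : ℝ) (N : ℕ) (χ : ℝ × UnitAddTorus (Fin 3) → ℝ) (g : ℝ → ℝ)
      (Ψ : EuclideanSpace ℝ (Fin 3) × EuclideanSpace ℝ (Fin 3) × EuclideanSpace ℝ (Fin 3) → ℝ)
      (r ϑ L κ τ : ℝ),
      Continuous χ → Continuous g → Continuous Ψ → (∃ C : ℝ, ∀ q, |Ψ q| ≤ C) → 0 < r → 0 ≤ L → 0 ≤ κ →
      Measurable (fun p : ℝ × Config (N + 1) (Fin 3) T3 => tubeStat σ N χ g Ψ r ϑ L κ p.1 p.2) ∧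
      ∃ B : ℝ, ∀ t ∈ Set.Icc (0 : ℝ) τ, ∀ z : Config (N + 1) (Fin 3) T3, |tubeStat σ N χ g Ψ r ϑ L κ t z| ≤ B :=
  fun σ N _χ _g _Ψ r ϑ L κ τ hχ hg hΨ hΨb hr hL hκ =>
    ⟨measurable_tubeStat_uncurry σ N hχ hg hΨ r ϑ L κ,
      exists_bound_tubeStat σ N hχ hg hΨb hr ϑ hL hκ τ⟩

end Summit.AtomisticToContinuum.HydrodynamicLimit.Theorems
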